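import Literature.Computability.AlgebraicComplexity.ABV17SingPermFourQuartics
import HarnessLib

/-!
# Alper–Bogart–Velasco 2017, §1: `codim Sing(perm_4) ≥ 7` — assembly at the standard pivot

Sixth file of the series (framing: `ABV17SingPermFourPrelim.lean`; chains:
`ABV17SingPermFourBlock.lean`, `ABV17SingPermFourChains.lean`; scalar case analysis:
`ABV17SingPermFourAlgebra.lean`; quartics and transposition: `ABV17SingPermFourQuartics.lean`).
`a` is a `4 × 4` point over a domain `L ⊇ K` (`2 ≠ 0` in `K`) with all sixteen `3 × 3`
subpermanents vanishing (`hvan`, six-term form) and the standard pivot `g = a₀₀a₁₁ + a₀₁a₁₀ ≠ 0`.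

* `seven_le_height_of_pivot` — **`7 ≤ ht (ker (f ↦ f(a)))`**: `BL = 0` or `TR = 0` (two zero
  rows / columns, `8`); `D ≠ 0` or `D' ≠ 0` (`seven_le_of_D_ne_zero`, transposed for `D'`); a
  right column with zero top or a bottom row with zero left (`seven_le_of_col_*_top_zero`,
  transposed for rows); a nonvanishing product `U₀₂U₀₃`, `U₁₂U₁₃`, `U'₀₂U'₀₃`, `U'₁₂U'₁₃`
  (`three_zeros_of_U_ne_zero`, three zero coordinates outside `BR`); split columns or split rows
  (`three_zeros_of_split`); same column and same row (`false_of_same`).  The scalar lemmas are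
  instantiated under the symmetries column `0 ↔ 1`, column `2 ↔ 3`, row `2 ↔ 3`, transpose.
The case split was found and checked exhaustive by enumerating all (point, pivot) pairs of the
variety over `𝔽₇` (prover notes, val-width-17819-w1); the Lean proof is self-contained.

Honest framing: dictionary work (von zur Gathen's problem at `k = 4`); VP ≠ VNP is NOT proved.

## References
* J. Alper, T. Bogart, M. Velasco, Found. Comput. Math. 17 (2017), arXiv:1505.02205, §1 p0003 L38.
  [AlperBogartVelasco2017]
-/

noncomputable section

open Matrix MvPolynomial Finset

namespace Literature.Computability.AlgebraicComplexity

open VonZurGathen BoraleviCarliniMichalekVentura2025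

namespace AlperBogartVelasco

variable {K : Type*} [Field K] {L : Type*} [CommRing L] [IsDomain L] [Algebra K L]

/-- **`codim Sing(perm_4) ≥ 7` at a point with the standard pivot**: if all `3 × 3` subpermanents
of the `4 × 4` matrix `a` over a domain `L ⊇ K` (`2 ≠ 0` in `K`) vanish and
`g = a₀₀a₁₁ + a₀₁a₁₀ ≠ 0`, then the prime `{f : f(a) = 0} ⊆ K[X_{4×4}]` has height `≥ 7`.  Case
analysis: `BL = 0` or `TR = 0` (eight zeros); `D ≠ 0` or `D' ≠ 0`; a right column with zero top or
a bottom row with zero left; a nonvanishing product `U₀₂U₀₃`, `U₁₂U₁₃`, `U'₀₂U'₀₃`, `U'₁₂U'₁₃`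
(three zeros); split columns or split rows (three zeros); same column and same row (absurd).
[cite: AlperBogartVelasco2017, §1 (sentence introducing Cor. 1.4), arXiv text p0003 L38] -/
theorem seven_le_height_of_pivot (h2 : (2 : K) ≠ 0) (a : Fin 4 × Fin 4 → L)
    (hvan : ∀ r₀ r₁ r₂ c₀ c₁ c₂ : Fin 4, r₀ ≠ r₁ → r₀ ≠ r₂ → r₁ ≠ r₂ → c₀ ≠ c₁ → c₀ ≠ c₂ → c₁ ≠ c₂ →
      a (r₀, c₀) * (a (r₁, c₁) * a (r₂, c₂) + a (r₁, c₂) * a (r₂, c₁)) +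
        a (r₀, c₁) * (a (r₁, c₀) * a (r₂, c₂) + a (r₁, c₂) * a (r₂, c₀)) +
        a (r₀, c₂) * (a (r₁, c₀) * a (r₂, c₁) + a (r₁, c₁) * a (r₂, c₀)) = 0)
    (hg : a (0, 0) * a (1, 1) + a (0, 1) * a (1, 0) ≠ 0) :
    (7 : ℕ∞) ≤ (RingHom.ker (aeval (R := K) a)).height := by
  have h2L : (2 : L) ≠ 0 := fun h =>
    h2 ((algebraMap K L).injective (by rw [map_ofNat, map_zero]; exact h))
  -- the pivot minors and the quartics, for `a` and for its transpose
  have hP : ∀ i j : Fin 4, i ≠ 0 → i ≠ 1 → j ≠ 0 → j ≠ 1 →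
      a (i, j) * (a (0, 0) * a (1, 1) + a (0, 1) * a (1, 0)) +
        a (i, 0) * (a (0, j) * a (1, 1) + a (0, 1) * a (1, j)) +
        a (i, 1) * (a (0, j) * a (1, 0) + a (0, 0) * a (1, j)) = 0 :=
    fun i j hi0 hi1 hj0 hj1 => hvan i 0 1 j 0 1 hi0 hi1 (by decide) hj0 hj1 (by decide)
  obtain ⟨⟨hE2, hE3⟩, ⟨hF2, hF3⟩, ⟨hE'2, hE'3⟩, ⟨hF'2, hF'3⟩⟩ := quartics_of_hvan (K := K) h2 a hvan
  have hvanT := hvan_transpose a hvan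
  have hPT : ∀ i j : Fin 4, i ≠ 0 → i ≠ 1 → j ≠ 0 → j ≠ 1 →
      (fun p : Fin 4 × Fin 4 => a (p.2, p.1)) (i, j) *
          ((fun p : Fin 4 × Fin 4 => a (p.2, p.1)) (0, 0) * (fun p : Fin 4 × Fin 4 => a (p.2, p.1)) (1, 1) +
            (fun p : Fin 4 × Fin 4 => a (p.2, p.1)) (0, 1) * (fun p : Fin 4 × Fin 4 => a (p.2, p.1)) (1, 0)) +
        (fun p : Fin 4 × Fin 4 => a (p.2, p.1)) (i, 0) *
          ((fun p : Fin 4 × Fin 4 => a (p.2, p.1)) (0, j) * (fun p : Fin 4 × Fin 4 => a (p.2, p.1)) (1, 1) +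
            (fun p : Fin 4 × Fin 4 => a (p.2, p.1)) (0, 1) * (fun p : Fin 4 × Fin 4 => a (p.2, p.1)) (1, j)) +
        (fun p : Fin 4 × Fin 4 => a (p.2, p.1)) (i, 1) *
          ((fun p : Fin 4 × Fin 4 => a (p.2, p.1)) (0, j) * (fun p : Fin 4 × Fin 4 => a (p.2, p.1)) (1, 0) +
            (fun p : Fin 4 × Fin 4 => a (p.2, p.1)) (0, 0) * (fun p : Fin 4 × Fin 4 => a (p.2, p.1)) (1, j)) = 0 :=
    fun i j hi0 hi1 hj0 hj1 => hvanT i 0 1 j 0 1 hi0 hi1 (by decide) hj0 hj1 (by decide)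
  have hgT : (fun p : Fin 4 × Fin 4 => a (p.2, p.1)) (0, 0) * (fun p : Fin 4 × Fin 4 => a (p.2, p.1)) (1, 1) +
      (fun p : Fin 4 × Fin 4 => a (p.2, p.1)) (0, 1) * (fun p : Fin 4 × Fin 4 => a (p.2, p.1)) (1, 0) ≠ 0 := by
    dsimp only; intro h; apply hg; linear_combination h
  -- (T1) `BL = 0` or `TR = 0`: two zero rows / columns
  by_cases hBL : a (2, 0) = 0 ∧ a (2, 1) = 0 ∧ a (3, 0) = 0 ∧ a (3, 1) = 0
  · obtain ⟨h20, h21, h30, h31⟩ := hBL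
    have hBR : ∀ i j : Fin 4, i ≠ 0 → i ≠ 1 → j ≠ 0 → j ≠ 1 → a (i, 0) = 0 → a (i, 1) = 0 →
        a (i, j) = 0 := by
      intro i j hi0 hi1 hj0 hj1 hi0' hi1'
      have h := hP i j hi0 hi1 hj0 hj1
      rw [hi0', hi1', zero_mul, zero_mul, add_zero, add_zero] at h
      exact (mul_eq_zero.1 h).resolve_right hg
    have row2 : ∀ j, a (2, j) = 0 := by
      intro j; fin_cases j
      · exact h20
      · exact h21
      · exact hBR 2 2 (by decide) (by decide) (by decide) (by decide) h20 h21
      · exact hBR 2 3 (by decide) (by decide) (by decide) (by decide) h20 h21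
    have row3 : ∀ j, a (3, j) = 0 := by
      intro j; fin_cases j
      · exact h30
      · exact h31
      · exact hBR 3 2 (by decide) (by decide) (by decide) (by decide) h30 h31
      · exact hBR 3 3 (by decide) (by decide) (by decide) (by decide) h30 h31
    exact le_trans (by norm_num) (eight_le_of_rows_zero (K := K) a row2 row3)
  by_cases hTR : a (0, 2) = 0 ∧ a (1, 2) = 0 ∧ a (0, 3) = 0 ∧ a (1, 3) = 0
  · obtain ⟨h02, h12, h03, h13⟩ := hTR
    have hBR : ∀ i j : Fin 4, i ≠ 0 → i ≠ 1 → j ≠ 0 → j ≠ 1 → a (0, j) = 0 → a (1, j) = 0 →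
        a (i, j) = 0 := by
      intro i j hi0 hi1 hj0 hj1 h0j h1j
      have h := hP i j hi0 hi1 hj0 hj1
      simp only [h0j, h1j, zero_mul, mul_zero, add_zero] at h
      exact (mul_eq_zero.1 h).resolve_right hg
    have col2 : ∀ i, a (i, 2) = 0 := by
      intro i; fin_cases i
      · exact h02
      · exact h12
      · exact hBR 2 2 (by decide) (by decide) (by decide) (by decide) h02 h12
      · exact hBR 3 2 (by decide) (by decide) (by decide) (by decide) h02 h12
    have col3 : ∀ i, a (i, 3) = 0 := by
      intro i; fin_cases i
      · exact h03
      · exact h13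
      · exact hBR 2 3 (by decide) (by decide) (by decide) (by decide) h03 h13
      · exact hBR 3 3 (by decide) (by decide) (by decide) (by decide) h03 h13
    exact le_trans (by norm_num) (eight_le_of_cols_zero (K := K) a col2 col3)
  -- (T2) `D ≠ 0`: the quartics `E₂, E₃` and `R1`
  by_cases hD : (a (0, 0) * a (0, 1) * a (1, 2) * a (1, 3) + a (0, 2) * a (0, 3) * a (1, 0) * a (1, 1)) = 0
  swap
  · have hR1 : (a (0, 0) * a (0, 1) * a (1, 2) * a (1, 3) + a (0, 2) * a (0, 3) * a (1, 0) * a (1, 1)) * (a (0, 0) * a (0, 1) * a (1, 2) * a (1, 3) + a (0, 2) * a (0, 3) * a (1, 0) * a (1, 1)) - (a (0, 0) * a (1, 2) + a (0, 2) * a (1, 0)) * (a (0, 0) * a (1, 3) + a (0, 3) * a (1, 0)) * ((a (0, 1) * a (1, 2) + a (0, 2) * a (1, 1)) * (a (0, 1) * a (1, 3) + a (0, 3) * a (1, 1))) = 0 := by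
      have k20 : a (2, 0) * ((a (0, 0) * a (0, 1) * a (1, 2) * a (1, 3) + a (0, 2) * a (0, 3) * a (1, 0) * a (1, 1)) * (a (0, 0) * a (0, 1) * a (1, 2) * a (1, 3) + a (0, 2) * a (0, 3) * a (1, 0) * a (1, 1)) - (a (0, 0) * a (1, 2) + a (0, 2) * a (1, 0)) * (a (0, 0) * a (1, 3) + a (0, 3) * a (1, 0)) * ((a (0, 1) * a (1, 2) + a (0, 2) * a (1, 1)) * (a (0, 1) * a (1, 3) + a (0, 3) * a (1, 1)))) = 0 := by
        linear_combination (a (0, 0) * a (0, 1) * a (1, 2) * a (1, 3) + a (0, 2) * a (0, 3) * a (1, 0) * a (1, 1)) * hE2 - ((a (0, 0) * a (1, 2) + a (0, 2) * a (1, 0)) * (a (0, 0) * a (1, 3) + a (0, 3) * a (1, 0))) * hF2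
      have k21 : a (2, 1) * ((a (0, 0) * a (0, 1) * a (1, 2) * a (1, 3) + a (0, 2) * a (0, 3) * a (1, 0) * a (1, 1)) * (a (0, 0) * a (0, 1) * a (1, 2) * a (1, 3) + a (0, 2) * a (0, 3) * a (1, 0) * a (1, 1)) - (a (0, 0) * a (1, 2) + a (0, 2) * a (1, 0)) * (a (0, 0) * a (1, 3) + a (0, 3) * a (1, 0)) * ((a (0, 1) * a (1, 2) + a (0, 2) * a (1, 1)) * (a (0, 1) * a (1, 3) + a (0, 3) * a (1, 1)))) = 0 := by
        linear_combination (a (0, 0) * a (0, 1) * a (1, 2) * a (1, 3) + a (0, 2) * a (0, 3) * a (1, 0) * a (1, 1)) * hF2 - ((a (0, 1) * a (1, 2) + a (0, 2) * a (1, 1)) * (a (0, 1) * a (1, 3) + a (0, 3) * a (1, 1))) * hE2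
      have k30 : a (3, 0) * ((a (0, 0) * a (0, 1) * a (1, 2) * a (1, 3) + a (0, 2) * a (0, 3) * a (1, 0) * a (1, 1)) * (a (0, 0) * a (0, 1) * a (1, 2) * a (1, 3) + a (0, 2) * a (0, 3) * a (1, 0) * a (1, 1)) - (a (0, 0) * a (1, 2) + a (0, 2) * a (1, 0)) * (a (0, 0) * a (1, 3) + a (0, 3) * a (1, 0)) * ((a (0, 1) * a (1, 2) + a (0, 2) * a (1, 1)) * (a (0, 1) * a (1, 3) + a (0, 3) * a (1, 1)))) = 0 := by
        linear_combination (a (0, 0) * a (0, 1) * a (1, 2) * a (1, 3) + a (0, 2) * a (0, 3) * a (1, 0) * a (1, 1)) * hE3 - ((a (0, 0) * a (1, 2) + a (0, 2) * a (1, 0)) * (a (0, 0) * a (1, 3) + a (0, 3) * a (1, 0))) * hF3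
      have k31 : a (3, 1) * ((a (0, 0) * a (0, 1) * a (1, 2) * a (1, 3) + a (0, 2) * a (0, 3) * a (1, 0) * a (1, 1)) * (a (0, 0) * a (0, 1) * a (1, 2) * a (1, 3) + a (0, 2) * a (0, 3) * a (1, 0) * a (1, 1)) - (a (0, 0) * a (1, 2) + a (0, 2) * a (1, 0)) * (a (0, 0) * a (1, 3) + a (0, 3) * a (1, 0)) * ((a (0, 1) * a (1, 2) + a (0, 2) * a (1, 1)) * (a (0, 1) * a (1, 3) + a (0, 3) * a (1, 1)))) = 0 := by
        linear_combination (a (0, 0) * a (0, 1) * a (1, 2) * a (1, 3) + a (0, 2) * a (0, 3) * a (1, 0) * a (1, 1)) * hF3 - ((a (0, 1) * a (1, 2) + a (0, 2) * a (1, 1)) * (a (0, 1) * a (1, 3) + a (0, 3) * a (1, 1))) * hE3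
      by_contra hne
      exact hBL ⟨(mul_eq_zero.1 k20).resolve_right hne, (mul_eq_zero.1 k21).resolve_right hne,
        (mul_eq_zero.1 k30).resolve_right hne, (mul_eq_zero.1 k31).resolve_right hne⟩
    refine seven_le_of_D_ne_zero (K := K) a hg hP hD ?_ hR1
    intro i hi0 hi1
    rcases fin_four_eq_two_or_three i hi0 hi1 with rfl | rfl
    · exact hE2
    · exact hE3
  -- (T2') `D' ≠ 0`: the same for the transpose
  by_cases hD' : (a (0, 0) * a (1, 0) * a (2, 1) * a (3, 1) + a (2, 0) * a (3, 0) * a (0, 1) * a (1, 1)) = 0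
  swap
  · have hR1' : (a (0, 0) * a (1, 0) * a (2, 1) * a (3, 1) + a (2, 0) * a (3, 0) * a (0, 1) * a (1, 1)) * (a (0, 0) * a (1, 0) * a (2, 1) * a (3, 1) + a (2, 0) * a (3, 0) * a (0, 1) * a (1, 1)) - (a (0, 0) * a (2, 1) + a (2, 0) * a (0, 1)) * (a (0, 0) * a (3, 1) + a (3, 0) * a (0, 1)) * ((a (1, 0) * a (2, 1) + a (2, 0) * a (1, 1)) * (a (1, 0) * a (3, 1) + a (3, 0) * a (1, 1))) = 0 := by
      have k02 : a (0, 2) * ((a (0, 0) * a (1, 0) * a (2, 1) * a (3, 1) + a (2, 0) * a (3, 0) * a (0, 1) * a (1, 1)) * (a (0, 0) * a (1, 0) * a (2, 1) * a (3, 1) + a (2, 0) * a (3, 0) * a (0, 1) * a (1, 1)) - (a (0, 0) * a (2, 1) + a (2, 0) * a (0, 1)) * (a (0, 0) * a (3, 1) + a (3, 0) * a (0, 1)) * ((a (1, 0) * a (2, 1) + a (2, 0) * a (1, 1)) * (a (1, 0) * a (3, 1) + a (3, 0) * a (1, 1)))) = 0 := by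
        linear_combination (a (0, 0) * a (1, 0) * a (2, 1) * a (3, 1) + a (2, 0) * a (3, 0) * a (0, 1) * a (1, 1)) * hE'2 - ((a (0, 0) * a (2, 1) + a (2, 0) * a (0, 1)) * (a (0, 0) * a (3, 1) + a (3, 0) * a (0, 1))) * hF'2
      have k12 : a (1, 2) * ((a (0, 0) * a (1, 0) * a (2, 1) * a (3, 1) + a (2, 0) * a (3, 0) * a (0, 1) * a (1, 1)) * (a (0, 0) * a (1, 0) * a (2, 1) * a (3, 1) + a (2, 0) * a (3, 0) * a (0, 1) * a (1, 1)) - (a (0, 0) * a (2, 1) + a (2, 0) * a (0, 1)) * (a (0, 0) * a (3, 1) + a (3, 0) * a (0, 1)) * ((a (1, 0) * a (2, 1) + a (2, 0) * a (1, 1)) * (a (1, 0) * a (3, 1) + a (3, 0) * a (1, 1)))) = 0 := by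
        linear_combination (a (0, 0) * a (1, 0) * a (2, 1) * a (3, 1) + a (2, 0) * a (3, 0) * a (0, 1) * a (1, 1)) * hF'2 - ((a (1, 0) * a (2, 1) + a (2, 0) * a (1, 1)) * (a (1, 0) * a (3, 1) + a (3, 0) * a (1, 1))) * hE'2
      have k03 : a (0, 3) * ((a (0, 0) * a (1, 0) * a (2, 1) * a (3, 1) + a (2, 0) * a (3, 0) * a (0, 1) * a (1, 1)) * (a (0, 0) * a (1, 0) * a (2, 1) * a (3, 1) + a (2, 0) * a (3, 0) * a (0, 1) * a (1, 1)) - (a (0, 0) * a (2, 1) + a (2, 0) * a (0, 1)) * (a (0, 0) * a (3, 1) + a (3, 0) * a (0, 1)) * ((a (1, 0) * a (2, 1) + a (2, 0) * a (1, 1)) * (a (1, 0) * a (3, 1) + a (3, 0) * a (1, 1)))) = 0 := by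
        linear_combination (a (0, 0) * a (1, 0) * a (2, 1) * a (3, 1) + a (2, 0) * a (3, 0) * a (0, 1) * a (1, 1)) * hE'3 - ((a (0, 0) * a (2, 1) + a (2, 0) * a (0, 1)) * (a (0, 0) * a (3, 1) + a (3, 0) * a (0, 1))) * hF'3
      have k13 : a (1, 3) * ((a (0, 0) * a (1, 0) * a (2, 1) * a (3, 1) + a (2, 0) * a (3, 0) * a (0, 1) * a (1, 1)) * (a (0, 0) * a (1, 0) * a (2, 1) * a (3, 1) + a (2, 0) * a (3, 0) * a (0, 1) * a (1, 1)) - (a (0, 0) * a (2, 1) + a (2, 0) * a (0, 1)) * (a (0, 0) * a (3, 1) + a (3, 0) * a (0, 1)) * ((a (1, 0) * a (2, 1) + a (2, 0) * a (1, 1)) * (a (1, 0) * a (3, 1) + a (3, 0) * a (1, 1)))) = 0 := by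
        linear_combination (a (0, 0) * a (1, 0) * a (2, 1) * a (3, 1) + a (2, 0) * a (3, 0) * a (0, 1) * a (1, 1)) * hF'3 - ((a (1, 0) * a (2, 1) + a (2, 0) * a (1, 1)) * (a (1, 0) * a (3, 1) + a (3, 0) * a (1, 1))) * hE'3
      by_contra hne
      exact hTR ⟨(mul_eq_zero.1 k02).resolve_right hne, (mul_eq_zero.1 k12).resolve_right hne,
        (mul_eq_zero.1 k03).resolve_right hne, (mul_eq_zero.1 k13).resolve_right hne⟩
    rw [← height_ker_aeval_transpose (K := K) a]
    refine seven_le_of_D_ne_zero (K := K) (fun p : Fin 4 × Fin 4 => a (p.2, p.1)) hgT hPT ?_ ?_ ?_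
    · dsimp only; intro h; apply hD'; linear_combination h
    · intro i hi0 hi1
      rcases fin_four_eq_two_or_three i hi0 hi1 with rfl | rfl
      · dsimp only; linear_combination hE'2
      · dsimp only; linear_combination hE'3
    · dsimp only; linear_combination hR1'
  -- (T3) a right column with zero top, a bottom row with zero left
  by_cases hc2 : a (0, 2) = 0 ∧ a (1, 2) = 0
  · exact seven_le_of_col_two_top_zero (K := K) a hg hP hc2.1 hc2.2 hE'3
  by_cases hc3 : a (0, 3) = 0 ∧ a (1, 3) = 0
  · exact seven_le_of_col_three_top_zero (K := K) a hg hP hc3.1 hc3.2 hE'2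
  by_cases hr2 : a (2, 0) = 0 ∧ a (2, 1) = 0
  · rw [← height_ker_aeval_transpose (K := K) a]
    refine seven_le_of_col_two_top_zero (K := K) (fun p : Fin 4 × Fin 4 => a (p.2, p.1)) hgT hPT
      hr2.1 hr2.2 ?_
    dsimp only; linear_combination hE3
  by_cases hr3 : a (3, 0) = 0 ∧ a (3, 1) = 0
  · rw [← height_ker_aeval_transpose (K := K) a]
    refine seven_le_of_col_three_top_zero (K := K) (fun p : Fin 4 × Fin 4 => a (p.2, p.1)) hgT hPT
      hr3.1 hr3.2 ?_
    dsimp only; linear_combination hE2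
  -- abbreviation for the three-zeros exit
  have Z3 : ∀ x y z : Fin 4 × Fin 4, x ≠ y → x ≠ z → y ≠ z →
      x ∉ ({(2, 2), (2, 3), (3, 2), (3, 3)} : Finset (Fin 4 × Fin 4)) →
      y ∉ ({(2, 2), (2, 3), (3, 2), (3, 3)} : Finset (Fin 4 × Fin 4)) →
      z ∉ ({(2, 2), (2, 3), (3, 2), (3, 3)} : Finset (Fin 4 × Fin 4)) →
      a x = 0 → a y = 0 → a z = 0 → (7 : ℕ∞) ≤ (RingHom.ker (aeval (R := K) a)).height :=
    fun x y z hxy hxz hyz hx hy hz hax hay haz =>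
      seven_le_of_three_zeros (K := K) a hg hP x y z hxy hxz hyz hx hy hz hax hay haz
  -- the four products
  by_cases hu0 : (a (0, 0) * a (1, 2) + a (0, 2) * a (1, 0)) * (a (0, 0) * a (1, 3) + a (0, 3) * a (1, 0)) = 0
  swap
  · obtain ⟨h21, h31, hbd⟩ := three_zeros_of_U_ne_zero hu0 hD hD' hE2 hE3 hE'2 hF'2 hr2 hr3 hc2
    rcases hbd with h01 | h11
    · exact Z3 (2, 1) (3, 1) (0, 1) (by decide) (by decide) (by decide) (by decide) (by decide)
        (by decide) h21 h31 h01
    · exact Z3 (2, 1) (3, 1) (1, 1) (by decide) (by decide) (by decide) (by decide) (by decide)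
        (by decide) h21 h31 h11
  by_cases hu1 : (a (0, 1) * a (1, 2) + a (0, 2) * a (1, 1)) * (a (0, 1) * a (1, 3) + a (0, 3) * a (1, 1)) = 0
  swap
  · -- columns `0 ↔ 1`
    obtain ⟨h20, h30, hac⟩ := three_zeros_of_U_ne_zero (a := a (0, 1)) (b := a (0, 0)) (c := a (1, 1))
      (d := a (1, 0)) (p := a (0, 2)) (q := a (1, 2)) (p' := a (0, 3)) (q' := a (1, 3)) (s := a (2, 1))
      (t := a (2, 0)) (s' := a (3, 1)) (t' := a (3, 0))
      (by intro h; apply hu1; linear_combination h) (by linear_combination hD) (by linear_combination hD')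
      (by linear_combination hF2) (by linear_combination hF3) (by linear_combination hE'2)
      (by linear_combination hF'2) (fun h => hr2 ⟨h.2, h.1⟩) (fun h => hr3 ⟨h.2, h.1⟩) hc2
    rcases hac with h00 | h10
    · exact Z3 (2, 0) (3, 0) (0, 0) (by decide) (by decide) (by decide) (by decide) (by decide)
        (by decide) h20 h30 h00
    · exact Z3 (2, 0) (3, 0) (1, 0) (by decide) (by decide) (by decide) (by decide) (by decide)
        (by decide) h20 h30 h10
  by_cases hu'0 : (a (0, 0) * a (2, 1) + a (2, 0) * a (0, 1)) * (a (0, 0) * a (3, 1) + a (3, 0) * a (0, 1)) = 0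
  swap
  · -- transpose
    obtain ⟨h12, h13, hcd⟩ := three_zeros_of_U_ne_zero (a := a (0, 0)) (b := a (1, 0)) (c := a (0, 1))
      (d := a (1, 1)) (p := a (2, 0)) (q := a (2, 1)) (p' := a (3, 0)) (q' := a (3, 1)) (s := a (0, 2))
      (t := a (1, 2)) (s' := a (0, 3)) (t' := a (1, 3))
      (by intro h; apply hu'0; linear_combination h) (by linear_combination hD') (by linear_combination hD)
      (by linear_combination hE'2) (by linear_combination hE'3) (by linear_combination hE2)
      (by linear_combination hF2) hc2 hc3 hr2
    rcases hcd with h10 | h11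
    · exact Z3 (1, 2) (1, 3) (1, 0) (by decide) (by decide) (by decide) (by decide) (by decide)
        (by decide) h12 h13 h10
    · exact Z3 (1, 2) (1, 3) (1, 1) (by decide) (by decide) (by decide) (by decide) (by decide)
        (by decide) h12 h13 h11
  by_cases hu'1 : (a (1, 0) * a (2, 1) + a (2, 0) * a (1, 1)) * (a (1, 0) * a (3, 1) + a (3, 0) * a (1, 1)) = 0
  swap
  · -- transpose and columns `0 ↔ 1`
    obtain ⟨h02, h03, hab⟩ := three_zeros_of_U_ne_zero (a := a (1, 0)) (b := a (0, 0)) (c := a (1, 1))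
      (d := a (0, 1)) (p := a (2, 0)) (q := a (2, 1)) (p' := a (3, 0)) (q' := a (3, 1)) (s := a (1, 2))
      (t := a (0, 2)) (s' := a (1, 3)) (t' := a (0, 3))
      (by intro h; apply hu'1; linear_combination h) (by linear_combination hD') (by linear_combination hD)
      (by linear_combination hF'2) (by linear_combination hF'3) (by linear_combination hE2)
      (by linear_combination hF2) (fun h => hc2 ⟨h.2, h.1⟩) (fun h => hc3 ⟨h.2, h.1⟩) hr2
    rcases hab with h00 | h01
    · exact Z3 (0, 2) (0, 3) (0, 0) (by decide) (by decide) (by decide) (by decide) (by decide)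
        (by decide) h02 h03 h00
    · exact Z3 (0, 2) (0, 3) (0, 1) (by decide) (by decide) (by decide) (by decide) (by decide)
        (by decide) h02 h03 h01
  -- all four products vanish: same / split columns and rows
  by_cases hsc : ((a (0, 0) * a (1, 2) + a (0, 2) * a (1, 0)) = 0 ∧ (a (0, 1) * a (1, 2) + a (0, 2) * a (1, 1)) = 0) ∨ ((a (0, 0) * a (1, 3) + a (0, 3) * a (1, 0)) = 0 ∧ (a (0, 1) * a (1, 3) + a (0, 3) * a (1, 1)) = 0)
  swap
  · -- split columns: three zeros
    have hsplit : ((a (0, 0) * a (1, 2) + a (0, 2) * a (1, 0)) = 0 ∧ (a (0, 1) * a (1, 3) + a (0, 3) * a (1, 1)) = 0) ∨ ((a (0, 0) * a (1, 3) + a (0, 3) * a (1, 0)) = 0 ∧ (a (0, 1) * a (1, 2) + a (0, 2) * a (1, 1)) = 0) := by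
      rcases mul_eq_zero.1 hu0 with h | h
      · have h' : (a (0, 1) * a (1, 2) + a (0, 2) * a (1, 1)) ≠ 0 := fun h' => hsc (Or.inl ⟨h, h'⟩)
        exact Or.inl ⟨h, (mul_eq_zero.1 hu1).resolve_left h'⟩
      · have h' : (a (0, 1) * a (1, 3) + a (0, 3) * a (1, 1)) ≠ 0 := fun h' => hsc (Or.inr ⟨h, h'⟩)
        exact Or.inr ⟨h, (mul_eq_zero.1 hu1).resolve_right h'⟩
    rcases hsplit with ⟨k02, k13⟩ | ⟨k03, k12⟩
    · rcases three_zeros_of_split (a := a (0, 0)) (b := a (0, 1)) (c := a (1, 0)) (d := a (1, 1))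
        (p := a (0, 2)) (q := a (1, 2)) (p' := a (0, 3)) (q' := a (1, 3)) (s := a (2, 0)) (t := a (2, 1))
        (s' := a (3, 0)) (t' := a (3, 1)) h2L (by intro h; apply hg; linear_combination h)
        (by linear_combination k02) (by linear_combination k13) (by linear_combination hD)
        (by linear_combination hD') hc2 hc3 with
        ⟨h10, h12, h⟩ | ⟨h11, h13, h⟩ | ⟨h02, h00, h⟩ | ⟨h03, h01, h⟩
      · rcases h with h | h | h
        · exact Z3 (1, 0) (1, 2) (0, 1) (by decide) (by decide) (by decide) (by decide) (by decide) (by decide) h10 h12 h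
        · exact Z3 (1, 0) (1, 2) (2, 0) (by decide) (by decide) (by decide) (by decide) (by decide) (by decide) h10 h12 h
        · exact Z3 (1, 0) (1, 2) (3, 0) (by decide) (by decide) (by decide) (by decide) (by decide) (by decide) h10 h12 h
      · rcases h with h | h | h
        · exact Z3 (1, 1) (1, 3) (0, 0) (by decide) (by decide) (by decide) (by decide) (by decide) (by decide) h11 h13 h
        · exact Z3 (1, 1) (1, 3) (2, 1) (by decide) (by decide) (by decide) (by decide) (by decide) (by decide) h11 h13 h
        · exact Z3 (1, 1) (1, 3) (3, 1) (by decide) (by decide) (by decide) (by decide) (by decide) (by decide) h11 h13 h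
      · rcases h with h | h | h
        · exact Z3 (0, 2) (0, 0) (1, 1) (by decide) (by decide) (by decide) (by decide) (by decide) (by decide) h02 h00 h
        · exact Z3 (0, 2) (0, 0) (2, 0) (by decide) (by decide) (by decide) (by decide) (by decide) (by decide) h02 h00 h
        · exact Z3 (0, 2) (0, 0) (3, 0) (by decide) (by decide) (by decide) (by decide) (by decide) (by decide) h02 h00 h
      · rcases h with h | h | h
        · exact Z3 (0, 3) (0, 1) (1, 0) (by decide) (by decide) (by decide) (by decide) (by decide) (by decide) h03 h01 h
        · exact Z3 (0, 3) (0, 1) (2, 1) (by decide) (by decide) (by decide) (by decide) (by decide) (by decide) h03 h01 h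
        · exact Z3 (0, 3) (0, 1) (3, 1) (by decide) (by decide) (by decide) (by decide) (by decide) (by decide) h03 h01 h
    · -- columns `2 ↔ 3`
      rcases three_zeros_of_split (a := a (0, 0)) (b := a (0, 1)) (c := a (1, 0)) (d := a (1, 1))
        (p := a (0, 3)) (q := a (1, 3)) (p' := a (0, 2)) (q' := a (1, 2)) (s := a (2, 0)) (t := a (2, 1))
        (s' := a (3, 0)) (t' := a (3, 1)) h2L (by intro h; apply hg; linear_combination h)
        (by linear_combination k03) (by linear_combination k12) (by linear_combination hD)
        (by linear_combination hD') hc3 hc2 with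
        ⟨h10, h13, h⟩ | ⟨h11, h12, h⟩ | ⟨h03, h00, h⟩ | ⟨h02, h01, h⟩
      · rcases h with h | h | h
        · exact Z3 (1, 0) (1, 3) (0, 1) (by decide) (by decide) (by decide) (by decide) (by decide) (by decide) h10 h13 h
        · exact Z3 (1, 0) (1, 3) (2, 0) (by decide) (by decide) (by decide) (by decide) (by decide) (by decide) h10 h13 h
        · exact Z3 (1, 0) (1, 3) (3, 0) (by decide) (by decide) (by decide) (by decide) (by decide) (by decide) h10 h13 h
      · rcases h with h | h | h
        · exact Z3 (1, 1) (1, 2) (0, 0) (by decide) (by decide) (by decide) (by decide) (by decide) (by decide) h11 h12 h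
        · exact Z3 (1, 1) (1, 2) (2, 1) (by decide) (by decide) (by decide) (by decide) (by decide) (by decide) h11 h12 h
        · exact Z3 (1, 1) (1, 2) (3, 1) (by decide) (by decide) (by decide) (by decide) (by decide) (by decide) h11 h12 h
      · rcases h with h | h | h
        · exact Z3 (0, 3) (0, 0) (1, 1) (by decide) (by decide) (by decide) (by decide) (by decide) (by decide) h03 h00 h
        · exact Z3 (0, 3) (0, 0) (2, 0) (by decide) (by decide) (by decide) (by decide) (by decide) (by decide) h03 h00 h
        · exact Z3 (0, 3) (0, 0) (3, 0) (by decide) (by decide) (by decide) (by decide) (by decide) (by decide) h03 h00 h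
      · rcases h with h | h | h
        · exact Z3 (0, 2) (0, 1) (1, 0) (by decide) (by decide) (by decide) (by decide) (by decide) (by decide) h02 h01 h
        · exact Z3 (0, 2) (0, 1) (2, 1) (by decide) (by decide) (by decide) (by decide) (by decide) (by decide) h02 h01 h
        · exact Z3 (0, 2) (0, 1) (3, 1) (by decide) (by decide) (by decide) (by decide) (by decide) (by decide) h02 h01 h
  by_cases hsr : ((a (0, 0) * a (2, 1) + a (2, 0) * a (0, 1)) = 0 ∧ (a (1, 0) * a (2, 1) + a (2, 0) * a (1, 1)) = 0) ∨ ((a (0, 0) * a (3, 1) + a (3, 0) * a (0, 1)) = 0 ∧ (a (1, 0) * a (3, 1) + a (3, 0) * a (1, 1)) = 0)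
  swap
  · -- split rows (transpose): three zeros
    have hsplit : ((a (0, 0) * a (2, 1) + a (2, 0) * a (0, 1)) = 0 ∧ (a (1, 0) * a (3, 1) + a (3, 0) * a (1, 1)) = 0) ∨ ((a (0, 0) * a (3, 1) + a (3, 0) * a (0, 1)) = 0 ∧ (a (1, 0) * a (2, 1) + a (2, 0) * a (1, 1)) = 0) := by
      rcases mul_eq_zero.1 hu'0 with h | h
      · have h' : (a (1, 0) * a (2, 1) + a (2, 0) * a (1, 1)) ≠ 0 := fun h' => hsr (Or.inl ⟨h, h'⟩)
        exact Or.inl ⟨h, (mul_eq_zero.1 hu'1).resolve_left h'⟩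
      · have h' : (a (1, 0) * a (3, 1) + a (3, 0) * a (1, 1)) ≠ 0 := fun h' => hsr (Or.inr ⟨h, h'⟩)
        exact Or.inr ⟨h, (mul_eq_zero.1 hu'1).resolve_right h'⟩
    rcases hsplit with ⟨k02, k13⟩ | ⟨k03, k12⟩
    · rcases three_zeros_of_split (a := a (0, 0)) (b := a (1, 0)) (c := a (0, 1)) (d := a (1, 1))
        (p := a (2, 0)) (q := a (2, 1)) (p' := a (3, 0)) (q' := a (3, 1)) (s := a (0, 2)) (t := a (1, 2))
        (s' := a (0, 3)) (t' := a (1, 3)) h2L (by intro h; apply hg; linear_combination h)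
        (by linear_combination k02) (by linear_combination k13) (by linear_combination hD')
        (by linear_combination hD) hr2 hr3 with
        ⟨h01, h21, h⟩ | ⟨h11, h31, h⟩ | ⟨h20, h00, h⟩ | ⟨h30, h10, h⟩
      · rcases h with h | h | h
        · exact Z3 (0, 1) (2, 1) (1, 0) (by decide) (by decide) (by decide) (by decide) (by decide) (by decide) h01 h21 h
        · exact Z3 (0, 1) (2, 1) (0, 2) (by decide) (by decide) (by decide) (by decide) (by decide) (by decide) h01 h21 h
        · exact Z3 (0, 1) (2, 1) (0, 3) (by decide) (by decide) (by decide) (by decide) (by decide) (by decide) h01 h21 h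
      · rcases h with h | h | h
        · exact Z3 (1, 1) (3, 1) (0, 0) (by decide) (by decide) (by decide) (by decide) (by decide) (by decide) h11 h31 h
        · exact Z3 (1, 1) (3, 1) (1, 2) (by decide) (by decide) (by decide) (by decide) (by decide) (by decide) h11 h31 h
        · exact Z3 (1, 1) (3, 1) (1, 3) (by decide) (by decide) (by decide) (by decide) (by decide) (by decide) h11 h31 h
      · rcases h with h | h | h
        · exact Z3 (2, 0) (0, 0) (1, 1) (by decide) (by decide) (by decide) (by decide) (by decide) (by decide) h20 h00 h
        · exact Z3 (2, 0) (0, 0) (0, 2) (by decide) (by decide) (by decide) (by decide) (by decide) (by decide) h20 h00 h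
        · exact Z3 (2, 0) (0, 0) (0, 3) (by decide) (by decide) (by decide) (by decide) (by decide) (by decide) h20 h00 h
      · rcases h with h | h | h
        · exact Z3 (3, 0) (1, 0) (0, 1) (by decide) (by decide) (by decide) (by decide) (by decide) (by decide) h30 h10 h
        · exact Z3 (3, 0) (1, 0) (1, 2) (by decide) (by decide) (by decide) (by decide) (by decide) (by decide) h30 h10 h
        · exact Z3 (3, 0) (1, 0) (1, 3) (by decide) (by decide) (by decide) (by decide) (by decide) (by decide) h30 h10 h
    · rcases three_zeros_of_split (a := a (0, 0)) (b := a (1, 0)) (c := a (0, 1)) (d := a (1, 1))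
        (p := a (3, 0)) (q := a (3, 1)) (p' := a (2, 0)) (q' := a (2, 1)) (s := a (0, 2)) (t := a (1, 2))
        (s' := a (0, 3)) (t' := a (1, 3)) h2L (by intro h; apply hg; linear_combination h)
        (by linear_combination k03) (by linear_combination k12) (by linear_combination hD')
        (by linear_combination hD) hr3 hr2 with
        ⟨h01, h31, h⟩ | ⟨h11, h21, h⟩ | ⟨h30, h00, h⟩ | ⟨h20, h10, h⟩
      · rcases h with h | h | h
        · exact Z3 (0, 1) (3, 1) (1, 0) (by decide) (by decide) (by decide) (by decide) (by decide) (by decide) h01 h31 h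
        · exact Z3 (0, 1) (3, 1) (0, 2) (by decide) (by decide) (by decide) (by decide) (by decide) (by decide) h01 h31 h
        · exact Z3 (0, 1) (3, 1) (0, 3) (by decide) (by decide) (by decide) (by decide) (by decide) (by decide) h01 h31 h
      · rcases h with h | h | h
        · exact Z3 (1, 1) (2, 1) (0, 0) (by decide) (by decide) (by decide) (by decide) (by decide) (by decide) h11 h21 h
        · exact Z3 (1, 1) (2, 1) (1, 2) (by decide) (by decide) (by decide) (by decide) (by decide) (by decide) h11 h21 h
        · exact Z3 (1, 1) (2, 1) (1, 3) (by decide) (by decide) (by decide) (by decide) (by decide) (by decide) h11 h21 h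
      · rcases h with h | h | h
        · exact Z3 (3, 0) (0, 0) (1, 1) (by decide) (by decide) (by decide) (by decide) (by decide) (by decide) h30 h00 h
        · exact Z3 (3, 0) (0, 0) (0, 2) (by decide) (by decide) (by decide) (by decide) (by decide) (by decide) h30 h00 h
        · exact Z3 (3, 0) (0, 0) (0, 3) (by decide) (by decide) (by decide) (by decide) (by decide) (by decide) h30 h00 h
      · rcases h with h | h | h
        · exact Z3 (2, 0) (1, 0) (0, 1) (by decide) (by decide) (by decide) (by decide) (by decide) (by decide) h20 h10 h
        · exact Z3 (2, 0) (1, 0) (1, 2) (by decide) (by decide) (by decide) (by decide) (by decide) (by decide) h20 h10 h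
        · exact Z3 (2, 0) (1, 0) (1, 3) (by decide) (by decide) (by decide) (by decide) (by decide) (by decide) h20 h10 h
  -- same column and same row: absurd
  exfalso
  have hA : ∀ j₁ j₂ i₁ i₂ : Fin 4, j₁ ≠ 0 → j₂ ≠ 0 → j₁ ≠ j₂ → i₁ ≠ 0 → i₂ ≠ 0 → i₁ ≠ i₂ →
      a (0, 0) * (a (i₁, j₁) * a (i₂, j₂) + a (i₁, j₂) * a (i₂, j₁)) +
        a (0, j₁) * (a (i₁, 0) * a (i₂, j₂) + a (i₁, j₂) * a (i₂, 0)) +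
        a (0, j₂) * (a (i₁, 0) * a (i₂, j₁) + a (i₁, j₁) * a (i₂, 0)) = 0 :=
    fun j₁ j₂ i₁ i₂ hj₁ hj₂ hj hi₁ hi₂ hi => hvan 0 i₁ i₂ 0 j₁ j₂ hi₁.symm hi₂.symm hi hj₁.symm hj₂.symm hj
  rcases hsc with ⟨k0, k1⟩ | ⟨k0, k1⟩ <;> rcases hsr with ⟨l0, l1⟩ | ⟨l0, l1⟩
  · exact false_of_same (a := a (0, 0)) (b := a (0, 1)) (c := a (1, 0)) (d := a (1, 1)) (p := a (0, 2)) (q := a (1, 2)) (p' := a (0, 3)) (q' := a (1, 3)) (s := a (2, 0)) (t := a (2, 1)) (s' := a (3, 0)) (t' := a (3, 1)) (m₂₂ := a (2, 2)) (m₂₃ := a (2, 3)) (m₃₂ := a (3, 2)) (m₃₃ := a (3, 3)) h2L (by intro h; apply hg; linear_combination h)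
      (by linear_combination k0) (by linear_combination k1) (by linear_combination l0)
      (by linear_combination l1) (by linear_combination hD) (by linear_combination hD')
      (by linear_combination hP 2 2 (by decide) (by decide) (by decide) (by decide))
      (by linear_combination hP 2 3 (by decide) (by decide) (by decide) (by decide))
      (by linear_combination hP 3 2 (by decide) (by decide) (by decide) (by decide))
      (by linear_combination hP 3 3 (by decide) (by decide) (by decide) (by decide))
      (by linear_combination hA 2 3 2 3 (by decide) (by decide) (by decide) (by decide) (by decide) (by decide))
      hc2 hc3 hr2 hr3
  · exact false_of_same (a := a (0, 0)) (b := a (0, 1)) (c := a (1, 0)) (d := a (1, 1)) (p := a (0, 2)) (q := a (1, 2)) (p' := a (0, 3)) (q' := a (1, 3)) (s := a (3, 0)) (t := a (3, 1)) (s' := a (2, 0)) (t' := a (2, 1)) (m₂₂ := a (3, 2)) (m₂₃ := a (3, 3)) (m₃₂ := a (2, 2)) (m₃₃ := a (2, 3)) h2L (by intro h; apply hg; linear_combination h)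
      (by linear_combination k0) (by linear_combination k1) (by linear_combination l0)
      (by linear_combination l1) (by linear_combination hD) (by linear_combination hD')
      (by linear_combination hP 3 2 (by decide) (by decide) (by decide) (by decide))
      (by linear_combination hP 3 3 (by decide) (by decide) (by decide) (by decide))
      (by linear_combination hP 2 2 (by decide) (by decide) (by decide) (by decide))
      (by linear_combination hP 2 3 (by decide) (by decide) (by decide) (by decide))
      (by linear_combination hA 2 3 3 2 (by decide) (by decide) (by decide) (by decide) (by decide) (by decide))
      hc2 hc3 hr3 hr2
  · exact false_of_same (a := a (0, 0)) (b := a (0, 1)) (c := a (1, 0)) (d := a (1, 1)) (p := a (0, 3)) (q := a (1, 3)) (p' := a (0, 2)) (q' := a (1, 2)) (s := a (2, 0)) (t := a (2, 1)) (s' := a (3, 0)) (t' := a (3, 1)) (m₂₂ := a (2, 3)) (m₂₃ := a (2, 2)) (m₃₂ := a (3, 3)) (m₃₃ := a (3, 2)) h2L (by intro h; apply hg; linear_combination h)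
      (by linear_combination k0) (by linear_combination k1) (by linear_combination l0)
      (by linear_combination l1) (by linear_combination hD) (by linear_combination hD')
      (by linear_combination hP 2 3 (by decide) (by decide) (by decide) (by decide))
      (by linear_combination hP 2 2 (by decide) (by decide) (by decide) (by decide))
      (by linear_combination hP 3 3 (by decide) (by decide) (by decide) (by decide))
      (by linear_combination hP 3 2 (by decide) (by decide) (by decide) (by decide))
      (by linear_combination hA 3 2 2 3 (by decide) (by decide) (by decide) (by decide) (by decide) (by decide))
      hc3 hc2 hr2 hr3
  · exact false_of_same (a := a (0, 0)) (b := a (0, 1)) (c := a (1, 0)) (d := a (1, 1)) (p := a (0, 3)) (q := a (1, 3)) (p' := a (0, 2)) (q' := a (1, 2)) (s := a (3, 0)) (t := a (3, 1)) (s' := a (2, 0)) (t' := a (2, 1)) (m₂₂ := a (3, 3)) (m₂₃ := a (3, 2)) (m₃₂ := a (2, 3)) (m₃₃ := a (2, 2)) h2L (by intro h; apply hg; linear_combination h)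
      (by linear_combination k0) (by linear_combination k1) (by linear_combination l0)
      (by linear_combination l1) (by linear_combination hD) (by linear_combination hD')
      (by linear_combination hP 3 3 (by decide) (by decide) (by decide) (by decide))
      (by linear_combination hP 3 2 (by decide) (by decide) (by decide) (by decide))
      (by linear_combination hP 2 3 (by decide) (by decide) (by decide) (by decide))
      (by linear_combination hP 2 2 (by decide) (by decide) (by decide) (by decide))
      (by linear_combination hA 3 2 3 2 (by decide) (by decide) (by decide) (by decide) (by decide) (by decide))
      hc3 hc2 hr3 hr2

end AlperBogartVelasco

end Literature.Computability.AlgebraicComplexity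

end
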